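import Mathlib
import HarnessLib

/-!
# Roth's theorem after Schmidt (LNM 785, Ch. V) — preliminaries

Source: W. M. Schmidt, *Diophantine Approximation*, Lecture Notes in Mathematics 785, Springer
(1980), Chapter V "Roth's Theorem", §§5–6 and §10 [Schmidt1980]. Schmidt (p. 117) follows
Cassels (1957); the theorem is K. F. Roth, Mathematika 2 (1955) [Roth1955].

This file fixes the vocabulary in which the three theorems of Chapter V (the Index Theorem 7A,
Theorem 8A on the index at nearby rational points, and Roth's Lemma 10A) and the final assembly
(§11) are formalised in the sequel files `RothTaylor`, `RothIndexTheorem…`, `RothNearby…`,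
`RothWronskian`, `RothLemma…` of this directory, towards a sorry-free proof of the named fact
`Literature.NumberTheory.DiophantineGeometry.roth` (`AbcWave0.lean`, **abc.S13**):

* `Roth.hasseD i P` — the operator `P ↦ P_{i₁…i_m} = (1/(i₁!⋯i_m!)) ∂^{i₁+⋯+i_m} P/∂X₁^{i₁}⋯∂X_m^{i_m}`
  of §5, defined over any commutative semiring by the binomial formula (5.1)
  `P_i = Σ_j C(j₁,i₁)⋯C(j_m,i_m) c_j X^{j-i}` (a multivariate Hasse derivative; Mathlib has only
  the one-variable `Polynomial.hasseDeriv`), with its coefficient formula, linearity, the effect on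
  monomials and the degree bound;
* `Roth.height P = |P|`, the maximum of the absolute values of the (integer) coefficients (§5), and
  **Lemma 5A**: `|P_i| ≤ 2^{r₁+⋯+r_m} |P|` when `deg_{X_h} P ≤ r_h` — proved;
* `Roth.wt r i = Σ_h i_h / r_h`, the weighted order of a multi-index, and the predicate
  `Roth.IndexGe P a r t` ("the index of `P` at `a` with respect to `r` is `≥ t`", §6): every
  `P_i` with `wt r i < t` vanishes at `a`. Schmidt's index is `+∞` for `P = 0`; the predicate form
  is literally `t ≤ Ind P` for all `P` (including `P = 0`) and avoids extended reals. Upper bounds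
  `Ind P ≤ t` are expressed directly as `∃ i, wt r i ≤ t ∧ P_i(a) ≠ 0`;
* `Roth.omega m ε = ω(m, ε) = 24 · 2^{-m} (ε/12)^{2^{m-1}}`, the constant (10.2) of Roth's Lemma.

Design: points are `a : σ → A` in a commutative `R`-algebra `A` (in the applications `R = ℤ`,
`A = ℝ`, `σ = Fin m`), evaluation is `MvPolynomial.aeval a`. Nothing here is specific to Roth's
theorem beyond the names; no statement of Chapter V is weakened or altered here (this file states
none of them).

## References

* [Schmidt1980] W. M. Schmidt, *Diophantine Approximation*, LNM 785, Springer 1980, Ch. V §§5, 6, 10.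
* [Roth1955] K. F. Roth, *Rational approximations to algebraic numbers*, Mathematika 2 (1955) 1–20.
-/

noncomputable section

open MvPolynomial

namespace Literature.NumberTheory.DiophantineGeometry

namespace Roth

variable {σ : Type*} {R : Type*} [CommSemiring R]

/-! ### §5: the operators `P ↦ P_i` (multivariate Hasse derivatives) -/

/-- Schmidt's `P_{i₁⋯i_m} = (1/(i₁!⋯i_m!)) ∂^{i₁+⋯+i_m} P / ∂X₁^{i₁}⋯∂X_m^{i_m}` (Ch. V §5), defined
over any commutative semiring by the binomial formula (5.1):
`P_i = Σ_j C(j₁,i₁)⋯C(j_m,i_m) · c_j · X^{j-i}` where `P = Σ_j c_j X^j`. The product of binomial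
coefficients is taken over the support of `i` (elsewhere the factor is `C(j_h,0) = 1`); it vanishes
unless `i ≤ j`. [cite: Schmidt1980, Ch. V §5 (5.1)] -/
def hasseD (i : σ →₀ ℕ) (P : MvPolynomial σ R) : MvPolynomial σ R :=
  ∑ j ∈ P.support, monomial (j - i) (((i.prod fun h n => (j h).choose n : ℕ) : R) * coeff j P)

/-- The binomial factor `C(j₁,i₁)⋯C(j_m,i_m)` vanishes unless `i ≤ j`. [folklore] -/
theorem prod_choose_eq_zero_of_not_le {i j : σ →₀ ℕ} (hij : ¬ i ≤ j) :
    (i.prod fun h n => (j h).choose n) = 0 := by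
  classical
  rw [Finsupp.le_def] at hij
  push Not at hij
  obtain ⟨h0, hlt⟩ := hij
  apply Finset.prod_eq_zero (i := h0)
  · rw [Finsupp.mem_support_iff]; omega
  · exact Nat.choose_eq_zero_of_lt hlt

/-- The binomial factor `C(j₁,i₁)⋯C(j_m,i_m)` is positive when `i ≤ j`. [folklore] -/
theorem prod_choose_pos_of_le {i j : σ →₀ ℕ} (hij : i ≤ j) :
    0 < (i.prod fun h n => (j h).choose n) := by
  classical
  apply Finset.prod_pos
  intro h _
  exact Nat.choose_pos (hij h)

/-- Coefficient formula for `P_i`: the coefficient of `X^k` in `P_i` is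
`C(k₁+i₁,i₁)⋯C(k_m+i_m,i_m)` times the coefficient of `X^{k+i}` in `P` (Schmidt (5.1)).
[cite: Schmidt1980, Ch. V §5 (5.1)] -/
theorem coeff_hasseD (i k : σ →₀ ℕ) (P : MvPolynomial σ R) :
    coeff k (hasseD i P) = ((i.prod fun h n => ((k + i) h).choose n : ℕ) : R) * coeff (k + i) P := by
  classical
  unfold hasseD
  rw [coeff_sum]
  simp only [coeff_monomial]
  rw [Finset.sum_eq_single (k + i)]
  · simp
  · intro j _ hne
    split_ifs with h
    · have hij : ¬ i ≤ j := fun hle => hne (by rw [← h, tsub_add_cancel_of_le hle])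
      simp [prod_choose_eq_zero_of_not_le hij]
    · rfl
  · intro hk
    simp [notMem_support_iff.mp hk]

/-- `0_i = 0`. [folklore] -/
@[simp] theorem hasseD_zero (i : σ →₀ ℕ) : hasseD i (0 : MvPolynomial σ R) = 0 := by
  simp [hasseD]

/-- `P ↦ P_i` is additive. [folklore] -/
theorem hasseD_add (i : σ →₀ ℕ) (P Q : MvPolynomial σ R) :
    hasseD i (P + Q) = hasseD i P + hasseD i Q := by
  ext k
  simp only [coeff_hasseD, coeff_add, mul_add]

/-- `P ↦ P_i` commutes with scalars. [folklore] -/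
theorem hasseD_C_mul (i : σ →₀ ℕ) (c : R) (P : MvPolynomial σ R) :
    hasseD i (C c * P) = C c * hasseD i P := by
  ext k
  simp only [coeff_hasseD, coeff_C_mul]
  ring

/-- `P ↦ P_i` as an `R`-linear map. [folklore] -/
def hasseDLin (i : σ →₀ ℕ) : MvPolynomial σ R →ₗ[R] MvPolynomial σ R where
  toFun := hasseD i
  map_add' := hasseD_add i
  map_smul' c P := by
    simp only [RingHom.id_apply, smul_eq_C_mul]
    exact hasseD_C_mul i c P

/-- `hasseDLin i` is `hasseD i`. [folklore] -/
@[simp] theorem hasseDLin_apply (i : σ →₀ ℕ) (P : MvPolynomial σ R) :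
    hasseDLin i P = hasseD i P := rfl

/-- `(-P)_i = -P_i`. [folklore] -/
theorem hasseD_neg {S : Type*} [CommRing S] (i : σ →₀ ℕ) (P : MvPolynomial σ S) :
    hasseD i (-P) = -hasseD i P :=
  (hasseDLin i).map_neg P

/-- `(P - Q)_i = P_i - Q_i`. [folklore] -/
theorem hasseD_sub {S : Type*} [CommRing S] (i : σ →₀ ℕ) (P Q : MvPolynomial σ S) :
    hasseD i (P - Q) = hasseD i P - hasseD i Q :=
  (hasseDLin i).map_sub P Q

/-- `(Σ P)_i = Σ P_i`. [folklore] -/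
theorem hasseD_sum {ι : Type*} (i : σ →₀ ℕ) (s : Finset ι) (f : ι → MvPolynomial σ R) :
    hasseD i (∑ x ∈ s, f x) = ∑ x ∈ s, hasseD i (f x) :=
  map_sum (hasseDLin i) f s

/-- `(c • P)_i = c • P_i`. [folklore] -/
theorem hasseD_smul (i : σ →₀ ℕ) (c : R) (P : MvPolynomial σ R) :
    hasseD i (c • P) = c • hasseD i P :=
  (hasseDLin i).map_smul c P

/-- `P_0 = P`. [folklore] -/
@[simp] theorem hasseD_zero_index (P : MvPolynomial σ R) : hasseD 0 P = P := by
  ext k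
  simp [coeff_hasseD]

/-- `P_i` of a monomial: `(c X^j)_i = C(j,i) c X^{j-i}` (zero unless `i ≤ j`).
[cite: Schmidt1980, Ch. V §5 (5.1)] -/
theorem hasseD_monomial (i j : σ →₀ ℕ) (c : R) :
    hasseD i (monomial j c) = monomial (j - i) (((i.prod fun h n => (j h).choose n : ℕ) : R) * c) := by
  classical
  unfold hasseD
  rw [support_monomial]
  split_ifs with hc
  · simp [hc]
  · simp

/-- `P ↦ P_i` commutes with a change of coefficient ring. [folklore] -/
theorem map_hasseD {S : Type*} [CommSemiring S] (f : R →+* S) (i : σ →₀ ℕ)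
    (P : MvPolynomial σ R) : map f (hasseD i P) = hasseD i (map f P) := by
  ext k
  rw [coeff_map, coeff_hasseD, coeff_hasseD, coeff_map, map_mul, map_natCast]

/-- If `X^k` occurs in `P_i` then `X^{k+i}` occurs in `P`. [folklore] -/
theorem add_mem_support_of_mem_support_hasseD {i k : σ →₀ ℕ} {P : MvPolynomial σ R}
    (hk : k ∈ (hasseD i P).support) : k + i ∈ P.support := by
  rw [mem_support_iff] at hk ⊢
  intro h
  apply hk
  rw [coeff_hasseD, h, mul_zero]

/-- Degree bound: `deg_{X_h} P_i ≤ deg_{X_h} P - i_h`. [cite: Schmidt1980, Ch. V §5 (5.1)] -/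
theorem degreeOf_hasseD_le (h : σ) (i : σ →₀ ℕ) (P : MvPolynomial σ R) :
    degreeOf h (hasseD i P) ≤ degreeOf h P - i h := by
  rw [degreeOf_le_iff]
  intro k hk
  have hki := add_mem_support_of_mem_support_hasseD hk
  have := monomial_le_degreeOf h hki
  simp only [Finsupp.coe_add, Pi.add_apply] at this
  omega

/-- In particular `deg_{X_h} P_i ≤ deg_{X_h} P`. [folklore] -/
theorem degreeOf_hasseD_le' (h : σ) (i : σ →₀ ℕ) (P : MvPolynomial σ R) :
    degreeOf h (hasseD i P) ≤ degreeOf h P :=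
  (degreeOf_hasseD_le h i P).trans (Nat.sub_le _ _)

/-- `P_i = 0` as soon as `i_h` exceeds the degree of `P` in `X_h`. [folklore] -/
theorem hasseD_eq_zero_of_degreeOf_lt {h : σ} {i : σ →₀ ℕ} {P : MvPolynomial σ R}
    (hlt : degreeOf h P < i h) : hasseD i P = 0 := by
  classical
  by_contra hne
  obtain ⟨k, hk⟩ := support_nonempty.mpr hne
  have hki := add_mem_support_of_mem_support_hasseD hk
  have := monomial_le_degreeOf h hki
  simp only [Finsupp.coe_add, Pi.add_apply] at this
  omega

/-! ### §5: the height `|P|` and Lemma 5A -/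

/-- Schmidt's height `|P|` of an integer polynomial: the maximum of the absolute values of its
coefficients (`0` for `P = 0`). [cite: Schmidt1980, Ch. V §5] -/
def height (P : MvPolynomial σ ℤ) : ℕ :=
  P.support.sup fun j => (coeff j P).natAbs

/-- Every coefficient is bounded by the height. [folklore] -/
theorem natAbs_coeff_le_height (P : MvPolynomial σ ℤ) (j : σ →₀ ℕ) :
    (coeff j P).natAbs ≤ height P := by
  classical
  by_cases hj : j ∈ P.support
  · exact Finset.le_sup (f := fun j => (coeff j P).natAbs) hj
  · simp [notMem_support_iff.mp hj]

/-- `|P| ≤ H` iff every coefficient has absolute value `≤ H`. [folklore] -/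
theorem height_le_iff {P : MvPolynomial σ ℤ} {H : ℕ} :
    height P ≤ H ↔ ∀ j, (coeff j P).natAbs ≤ H := by
  constructor
  · intro h j
    exact (natAbs_coeff_le_height P j).trans h
  · intro h
    exact Finset.sup_le fun j _ => h j

/-- `|0| = 0` (junk-free: the empty supremum in `ℕ` is `0`). [folklore] -/
@[simp] theorem height_zero : height (0 : MvPolynomial σ ℤ) = 0 := by
  simp [height]

/-- A non-zero integer polynomial has height `≥ 1`. [folklore] -/
theorem one_le_height {P : MvPolynomial σ ℤ} (hP : P ≠ 0) : 1 ≤ height P := by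
  obtain ⟨j, hj⟩ := support_nonempty.mpr hP
  rw [mem_support_iff] at hj
  have : 1 ≤ (coeff j P).natAbs := Int.natAbs_pos.mpr hj
  exact this.trans (natAbs_coeff_le_height P j)

/-- The real absolute value of a coefficient is bounded by the height. [folklore] -/
theorem abs_coeff_le_height (P : MvPolynomial σ ℤ) (j : σ →₀ ℕ) :
    |((coeff j P : ℤ) : ℝ)| ≤ height P := by
  have h := natAbs_coeff_le_height P j
  have h' : (|coeff j P| : ℤ) ≤ height P := by
    rw [Int.abs_eq_natAbs]; exact_mod_cast h
  rw [← Int.cast_abs]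
  exact_mod_cast h'

/-- **Lemma 5A** (Schmidt, Ch. V §5): if `P` has integer coefficients then so does `P_i`
(automatic here), and if `P` has degree `≤ r_h` in `X_h` for every `h` then
`|P_i| ≤ 2^{r₁+⋯+r_m} |P|`. [cite: Schmidt1980, Ch. V Lemma 5A] -/
theorem height_hasseD_le [Fintype σ] (i : σ →₀ ℕ) (P : MvPolynomial σ ℤ) (r : σ → ℕ)
    (hdeg : ∀ h, degreeOf h P ≤ r h) :
    height (hasseD i P) ≤ 2 ^ (∑ h, r h) * height P := by
  classical
  rw [height_le_iff]
  intro k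
  rw [coeff_hasseD, Int.natAbs_mul, Int.natAbs_natCast]
  by_cases hk : coeff (k + i) P = 0
  · simp [hk]
  · have hmem : k + i ∈ P.support := mem_support_iff.mpr hk
    have hbound : ∀ h, (k + i) h ≤ r h := fun h =>
      (monomial_le_degreeOf h hmem).trans (hdeg h)
    gcongr
    · calc (i.prod fun h n => ((k + i) h).choose n)
          ≤ ∏ h ∈ i.support, 2 ^ r h := by
            apply Finset.prod_le_prod' fun h _ => ?_
            exact (Nat.choose_le_two_pow _ _).trans (Nat.pow_le_pow_right (by norm_num) (hbound h))
        _ ≤ ∏ h, 2 ^ r h := Finset.prod_le_prod_of_subset_of_one_le' (Finset.subset_univ _)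
            (fun h _ _ => Nat.one_le_two_pow)
        _ = 2 ^ ∑ h, r h := Finset.prod_pow_eq_pow_sum _ _ _
    · exact natAbs_coeff_le_height P (k + i)

/-! ### §6: weighted order and the index predicate -/

/-- The weighted order `i₁/r₁ + ⋯ + i_m/r_m` of a multi-index `i` with respect to positive
integer weights `r` (Schmidt, Ch. V §6). The weights are positive in every use; a weight `r_h = 0`
would contribute the junk value `i_h / 0 = 0`. [cite: Schmidt1980, Ch. V §6] -/
def wt [Fintype σ] (r : σ → ℕ) (i : σ →₀ ℕ) : ℝ :=
  ∑ h, (i h : ℝ) / (r h : ℝ)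

/-- Weighted orders are non-negative. [folklore] -/
theorem wt_nonneg [Fintype σ] (r : σ → ℕ) (i : σ →₀ ℕ) : 0 ≤ wt r i :=
  Finset.sum_nonneg fun _ _ => by positivity

/-- The weighted order of the zero multi-index is `0`. [folklore] -/
@[simp] theorem wt_zero [Fintype σ] (r : σ → ℕ) : wt r 0 = 0 := by
  simp [wt]

/-- The weighted order is additive. [folklore] -/
theorem wt_add [Fintype σ] (r : σ → ℕ) (i j : σ →₀ ℕ) : wt r (i + j) = wt r i + wt r j := by
  simp only [wt, Finsupp.coe_add, Pi.add_apply, Nat.cast_add, add_div, Finset.sum_add_distrib]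

/-- Scaling all weights by `k ≥ 1` divides the weighted order by `k`
(used in Lemma 10B: index w.r.t. `(kr₁,…,kr_m)` versus `(r₁,…,r_m)`). [folklore] -/
theorem wt_mul_left [Fintype σ] (k : ℕ) (hk : 0 < k) (r : σ → ℕ) (i : σ →₀ ℕ) :
    wt (fun h => k * r h) i = wt r i / k := by
  simp only [wt, Nat.cast_mul, Finset.sum_div]
  refine Finset.sum_congr rfl fun h _ => ?_
  have : (k : ℝ) ≠ 0 := by exact_mod_cast hk.ne'
  field_simp

variable {S : Type*} [CommRing S] {A : Type*} [CommRing A] [Algebra S A]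

/-- **The index is at least `t`** (Schmidt, Ch. V §6): `IndexGe P a r t` says that
`P_i(a) = 0` for every multi-index `i` with `i₁/r₁ + ⋯ + i_m/r_m < t`, i.e. that the index of
`P` at the point `a` with respect to the weights `r` is `≥ t` (for `P = 0`, whose index is `+∞`,
this holds for every `t`). [cite: Schmidt1980, Ch. V §6 Definition] -/
def IndexGe [Fintype σ] (P : MvPolynomial σ S) (a : σ → A) (r : σ → ℕ) (t : ℝ) : Prop :=
  ∀ i : σ →₀ ℕ, wt r i < t → aeval a (hasseD i P) = 0

/-- `Ind P ≥ t` and `s ≤ t` give `Ind P ≥ s`. [folklore] -/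
theorem IndexGe.mono [Fintype σ] {P : MvPolynomial σ S} {a : σ → A} {r : σ → ℕ} {s t : ℝ}
    (h : IndexGe P a r t) (hst : s ≤ t) : IndexGe P a r s :=
  fun i hi => h i (hi.trans_le hst)

/-- The zero polynomial has index `≥ t` for every `t` (Schmidt: `Ind 0 = +∞`).
[cite: Schmidt1980, Ch. V §6 Definition] -/
theorem indexGe_zero [Fintype σ] (a : σ → A) (r : σ → ℕ) (t : ℝ) :
    IndexGe (0 : MvPolynomial σ S) a r t :=
  fun i _ => by simp

/-- Every polynomial has index `≥ t` for `t ≤ 0`. [folklore] -/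
theorem indexGe_of_nonpos [Fintype σ] (P : MvPolynomial σ S) (a : σ → A) (r : σ → ℕ) {t : ℝ}
    (ht : t ≤ 0) : IndexGe P a r t :=
  fun i hi => absurd (hi.trans_le ht) (not_lt.mpr (wt_nonneg r i))

/-- **Lemma 6A (ii)** (Schmidt, Ch. V): `Ind (P + Q) ≥ min (Ind P, Ind Q)`, in predicate form.
[cite: Schmidt1980, Ch. V Lemma 6A (ii)] -/
theorem IndexGe.add [Fintype σ] {P Q : MvPolynomial σ S} {a : σ → A} {r : σ → ℕ} {t : ℝ}
    (hP : IndexGe P a r t) (hQ : IndexGe Q a r t) : IndexGe (P + Q) a r t :=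
  fun i hi => by rw [hasseD_add, map_add, hP i hi, hQ i hi, add_zero]

/-- `Ind (-P) ≥ t` if `Ind P ≥ t`. [folklore] -/
theorem IndexGe.neg [Fintype σ] {P : MvPolynomial σ S} {a : σ → A} {r : σ → ℕ} {t : ℝ}
    (hP : IndexGe P a r t) : IndexGe (-P) a r t :=
  fun i hi => by rw [hasseD_neg, map_neg, hP i hi, neg_zero]

/-- `Ind (P - Q) ≥ t` if `Ind P, Ind Q ≥ t`. [folklore] -/
theorem IndexGe.sub [Fintype σ] {P Q : MvPolynomial σ S} {a : σ → A} {r : σ → ℕ} {t : ℝ}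
    (hP : IndexGe P a r t) (hQ : IndexGe Q a r t) : IndexGe (P - Q) a r t := by
  rw [sub_eq_add_neg]; exact hP.add hQ.neg

/-- `Ind (c P) ≥ t` if `Ind P ≥ t`. [folklore] -/
theorem IndexGe.C_mul [Fintype σ] {P : MvPolynomial σ S} {a : σ → A} {r : σ → ℕ} {t : ℝ}
    (hP : IndexGe P a r t) (c : S) : IndexGe (C c * P) a r t :=
  fun i hi => by rw [hasseD_C_mul, map_mul, hP i hi, mul_zero]

/-- A finite sum of polynomials of index `≥ t` has index `≥ t`. [cite: Schmidt1980, Ch. V Lemma 6A (ii)] -/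
theorem IndexGe.sum [Fintype σ] {ι : Type*} {s : Finset ι} {f : ι → MvPolynomial σ S}
    {a : σ → A} {r : σ → ℕ} {t : ℝ} (h : ∀ x ∈ s, IndexGe (f x) a r t) :
    IndexGe (∑ x ∈ s, f x) a r t :=
  fun i hi => by
    rw [hasseD_sum, map_sum]
    exact Finset.sum_eq_zero fun x hx => h x hx i hi

/-- `IndexGe P a r t` for some `t > 0` forces `P(a) = 0`. [folklore] -/
theorem IndexGe.aeval_eq_zero [Fintype σ] {P : MvPolynomial σ S} {a : σ → A} {r : σ → ℕ}
    {t : ℝ} (h : IndexGe P a r t) (ht : 0 < t) : aeval a P = 0 := by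
  simpa using h 0 (by simpa using ht)

/-! ### §10: the constant `ω(m, ε)` of Roth's Lemma -/

/-- Schmidt's `ω = ω(m, ε) = 24 · 2^{-m} · (ε/12)^{2^{m-1}}` (Ch. V (10.2)); meaningful for
`m ≥ 1` (for `m = 0` the truncated exponent `2^{0-1} = 2^0` is a junk value never used).
[cite: Schmidt1980, Ch. V Theorem 10A (10.2)] -/
def omega (m : ℕ) (ε : ℝ) : ℝ :=
  24 * 2⁻¹ ^ m * (ε / 12) ^ (2 ^ (m - 1))

/-- `ω(m, ε) > 0` for `ε > 0`. [folklore] -/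
theorem omega_pos {m : ℕ} {ε : ℝ} (hε : 0 < ε) : 0 < omega m ε := by
  unfold omega; positivity

/-- `ω(1, ε) = ε`. [cite: Schmidt1980, Ch. V proof of Theorem 10A, case m = 1] -/
theorem omega_one (ε : ℝ) : omega 1 ε = ε := by
  simp [omega]; ring

/-- `ω(m-1, ε²/12) = 2 ω(m, ε)` for `m ≥ 2` (the inductive step of Roth's Lemma).
[cite: Schmidt1980, Ch. V proof of Lemma 10B] -/
theorem omega_pred_sq (m : ℕ) (hm : 2 ≤ m) (ε : ℝ) :
    omega (m - 1) (ε ^ 2 / 12) = 2 * omega m ε := by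
  obtain ⟨n, rfl⟩ : ∃ n, m = n + 2 := ⟨m - 2, by omega⟩
  simp only [omega, Nat.add_sub_cancel, show n + 2 - 1 = n + 1 from rfl]
  rw [show ε ^ 2 / 12 / 12 = (ε / 12) ^ 2 by ring, ← pow_mul, pow_succ, pow_succ, pow_succ]
  ring

end Roth

end Literature.NumberTheory.DiophantineGeometry
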